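import Literature.NumberTheory.LFunctions.VinogradovKorobovDirichletProofs
import Literature.NumberTheory.LFunctions.VinogradovKorobov
import Mathlib.Analysis.SumIntegralComparisons
import HarnessLib

/-!
# Khale 2024, Lemma 5.1: `|L(σ + it, χ)|` in the critical strip from Ford's Hurwitz-zeta bound (2.4)

Topic `Literature/NumberTheory/LFunctions`.  Everything in this file is PROVED; the only `def` is
the predicate `HasHurwitzFordBound A B` recording hypothesis (2.4) of the source with its two free
constants (no named fact is introduced).  **Lemma 5.1 of T. Khale, *An explicit Vinogradov–Korobov
zero-free region for Dirichlet L-functions*, Q. J. Math. 75 (2024) = arXiv:2210.06457v1 (p. 8)**, the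
first estimate of §5 ("Additional bounds for `|ζ(s)|` and `|L(s, χ)|`") on which the bootstrapping
Theorem 3.1 — the analytic core of the named fact
`Literature.NumberTheory.LFunctions.Khale2024_zeroFreeRegion`, see
`VinogradovKorobovDirichletProofs.lean` — is built:

> **(2.4)** "we will assume that there exist constants `A, B > 0` such that the Hurwitz zeta
> function … satisfies `|ζ(σ + it, u) − u^{−(σ+it)}| ≤ A t^{B(1−σ)^{3/2}} (log t)^{2/3}`,
> `t ≥ 3`, `1/2 ≤ σ ≤ 1`" (uniformly in `0 < u ≤ 1`; Ford, PLMS 85 (2002), Theorem 1: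
> `A = 76.2`, `B = 4.45`).
>
> **Lemma 5.1.** Assume that there exist positive constants `A` and `B` such that (2.4) holds. Let
> `q ≥ 3`, and let `χ` (mod `q`) be a Dirichlet character. If `|t| ≥ 3` and `1/2 ≤ σ ≤ 1`, then
> `|L(σ + it, χ)| ≤ A q^{1−σ} |t|^{B(1−σ)^{3/2}} (log|t|)^{2/3} + 1.92 (q^{1−σ} − 1)/(1 − σ)`.

Printed proof, followed here: `L(σ + it, χ) = q^{−s} ∑_{a=1}^{q} χ(a) ζ(s, a/q)` (periodicity of
`χ`; in Mathlib this is the DEFINITION of `DirichletCharacter.LFunction` through `ZMod.LFunction`,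
with `ζ(s, q/q) = ζ(s, 1) = ζ(s)` sitting at the residue `0`), so by (2.4)
`|L| ≤ A q^{1−σ} t^{B(1−σ)^{3/2}} (log t)^{2/3} + ∑_{a=1}^{q} a^{−σ}` (`norm_LFunction_le_sum`);
`∑_{a ≤ q} a^{−σ} ≤ 1 + ∫_1^q u^{−σ} du = 1 + (q^{1−σ} − 1)/(1 − σ)` (`sum_rpow_neg_le`);
`(q^{1−σ} − 1)/(1 − σ) ≥ log q ≥ log 3` and `1 + x ≤ 1.92 x` for `x ≥ log 3`
(`one_add_le_of_log_three_le`, with the tree's `VK.log_three_ge`).  Negative `t` by `L(s̄, χ) = conj L(s, χ̄)`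
(`conj_LFunction_conj_of_ne_one`).  The case `σ = 1` of the printed statement (where
`(q^{1−σ} − 1)/(1 − σ)` is to be read as its limit `log q`) is recorded separately
(`norm_LFunction_le_of_re_eq_one`); the source only uses `σ < 1` (Lemma 5.2, (5.3)).

## Main statements

* `HasHurwitzFordBound A B` — hypothesis (2.4), verbatim, in terms of Mathlib's `hurwitzZeta`.
* `KhaleL51.norm_LFunction_le_sum` — `|L(s, χ)| ≤ A q^{1−σ} t^{B(1−σ)^{3/2}}(log t)^{2/3} + ∑_{a=1}^q a^{−σ}`.
* `KhaleL51.norm_LFunction_le` — **Lemma 5.1** (`|t| ≥ 3`, `1/2 ≤ σ < 1`, `q ≥ 3`, every `χ` mod `q`).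
* `KhaleL51.norm_LFunction_le_of_re_eq_one` — the case `σ = 1`: `|L(1 + it, χ)| ≤ A (log|t|)^{2/3} + 1.92 log q`.

## References

* T. Khale, arXiv:2210.06457v1, (2.4) (p. 3) and Lemma 5.1 (p. 8). [Khale2024]
* K. Ford, *Vinogradov's integral and bounds for the Riemann zeta function*, Proc. London Math.
  Soc. (3) 85 (2002), 565–633, Theorem 1. [Ford2002]
-/

noncomputable section

open Complex Filter Topology Set Finset MeasureTheory intervalIntegral HurwitzZeta
open scoped ComplexConjugate

namespace Literature.NumberTheory.LFunctions

/-- **Hypothesis (2.4) of Khale 2024** (Ford's Richert-type bound for the Hurwitz zeta function,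
PLMS 85 (2002), Theorem 1, where `A = 76.2`, `B = 4.45`): for `0 < u ≤ 1`, `t ≥ 3` and
`1/2 ≤ σ ≤ 1`, `|ζ(σ + it, u) − u^{−(σ+it)}| ≤ A t^{B(1−σ)^{3/2}} (log t)^{2/3}`, where
`ζ(s, u) = ∑_{n ≥ 0} (n + u)^{−s}` (`Re s > 1`) is Mathlib's `hurwitzZeta (u : ℝ/ℤ)`
(`hasSum_hurwitzZeta_of_one_lt_re`; `u = 1 ≡ 0` gives `ζ(s, 1) = ζ(s)`).  A predicate in the two
constants, used as the hypothesis "(2.4) holds with `A`, `B`" of Lemmas 5.1, 5.2, 6.2–6.4, 9.1 and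
Theorem 3.1 of the source. [cite: Khale2024, (2.4)] -/
def HasHurwitzFordBound (A B : ℝ) : Prop :=
  ∀ u : ℝ, 0 < u → u ≤ 1 → ∀ σ t : ℝ, 3 ≤ t → 1 / 2 ≤ σ → σ ≤ 1 →
    ‖hurwitzZeta (u : UnitAddCircle) (σ + t * I) - (u : ℂ) ^ (-((σ : ℂ) + t * I))‖
      ≤ A * t ^ (B * (1 - σ) ^ (3 / 2 : ℝ)) * Real.log t ^ (2 / 3 : ℝ)

namespace KhaleL51

/-! ### The representatives `u_j ∈ (0, 1]` of the residues and `L(s, χ) = q^{-s} ∑ χ(j) ζ(s, u_j)` -/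

/-- The representative in `(0, 1]` of the residue `j` mod `q`: `j/q` for `j ≢ 0`, and `1` for
`j ≡ 0` (Khale's `a/q`, `1 ≤ a ≤ q`). [cite: Khale2024, proof of Lemma 5.1] -/
def rep {q : ℕ} (j : ZMod q) : ℝ := if j.val = 0 then 1 else (j.val : ℝ) / q

/-- `u_j > 0`. [folklore] -/
theorem rep_pos {q : ℕ} [NeZero q] (j : ZMod q) : 0 < rep j := by
  unfold rep
  split_ifs with h
  · exact one_pos
  · have hq : (0 : ℝ) < q := Nat.cast_pos.mpr (NeZero.pos q)
    exact div_pos (Nat.cast_pos.mpr (Nat.pos_of_ne_zero h)) hq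

/-- `u_j ≤ 1`. [folklore] -/
theorem rep_le_one {q : ℕ} [NeZero q] (j : ZMod q) : rep j ≤ 1 := by
  unfold rep
  split_ifs with h
  · exact le_rfl
  · have hq : (0 : ℝ) < q := Nat.cast_pos.mpr (NeZero.pos q)
    rw [div_le_one hq]
    exact_mod_cast (ZMod.val_lt j).le

/-- `toAddCircle j = u_j` in `ℝ/ℤ` (`j/q ≡ 1` when `j ≡ 0`). [folklore] -/
theorem toAddCircle_eq_rep {q : ℕ} [NeZero q] (j : ZMod q) :
    ZMod.toAddCircle j = ((rep j : ℝ) : UnitAddCircle) := by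
  rw [ZMod.toAddCircle_apply]
  unfold rep
  split_ifs with h
  · rw [h, Nat.cast_zero, zero_div]
    rw [AddCircle.coe_period]
    exact (AddCircle.coe_eq_zero_iff (p := (1 : ℝ))).2 ⟨0, by simp⟩
  · rfl

/-- `q · u_j` is the integer `a ∈ {1, …, q}` representing `j` (`a = q` for `j ≡ 0`). [folklore] -/
theorem mul_rep_eq {q : ℕ} [NeZero q] (j : ZMod q) :
    (q : ℝ) * rep j = if j.val = 0 then (q : ℝ) else (j.val : ℝ) := by
  unfold rep
  have hq : (q : ℝ) ≠ 0 := Nat.cast_ne_zero.mpr (NeZero.ne q)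
  split_ifs with h
  · rw [mul_one]
  · rw [mul_div_cancel₀ _ hq]

/-- Mathlib's definition of `L(s, χ)` read through the representatives `u_j`:
`L(s, χ) = q^{−s} ∑_j χ(j) ζ(s, u_j)` ("by the periodicity of the values of `χ(n)`").
[cite: Khale2024, proof of Lemma 5.1 (first display)] -/
theorem LFunction_eq_sum_hurwitzZeta {q : ℕ} [NeZero q] (χ : DirichletCharacter ℂ q) (s : ℂ) :
    χ.LFunction s = (q : ℂ) ^ (-s) * ∑ j : ZMod q, χ j * hurwitzZeta ((rep j : ℝ) : UnitAddCircle) s := by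
  rw [DirichletCharacter.LFunction, ZMod.LFunction]
  congr 1
  refine Finset.sum_congr rfl fun j _ => ?_
  rw [toAddCircle_eq_rep]

/-! ### `∑_j (q u_j)^{-σ} = ∑_{a=1}^{q} a^{-σ} ≤ 1 + (q^{1-σ} - 1)/(1 - σ)` -/

/-- `∑_{j mod q} (q u_j)^{−σ} = ∑_{a=1}^{q} a^{−σ}`. [cite: Khale2024, proof of Lemma 5.1] -/
theorem sum_mul_rep_rpow {q : ℕ} [NeZero q] (σ : ℝ) :
    ∑ j : ZMod q, ((q : ℝ) * rep j) ^ (-σ) = ∑ a ∈ Finset.Icc 1 q, (a : ℝ) ^ (-σ) := by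
  have hq : 1 ≤ q := NeZero.one_le
  refine Finset.sum_nbij' (fun j : ZMod q => if j.val = 0 then q else j.val) (fun a : ℕ => (a : ZMod q))
    ?_ ?_ ?_ ?_ ?_
  · intro j _
    rw [Finset.mem_Icc]
    split_ifs with h
    · exact ⟨hq, le_rfl⟩
    · exact ⟨Nat.pos_of_ne_zero h, (ZMod.val_lt j).le⟩
  · intro a _
    exact Finset.mem_univ _
  · intro j _
    split_ifs with h
    · rw [ZMod.natCast_self, eq_comm]
      exact (ZMod.val_eq_zero j).1 h
    · exact ZMod.natCast_zmod_val j
  · intro a ha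
    rw [Finset.mem_Icc] at ha
    simp only [ZMod.val_natCast]
    rcases ha.2.lt_or_eq with hlt | rfl
    · rw [Nat.mod_eq_of_lt hlt, if_neg (by omega)]
    · rw [Nat.mod_self, if_pos rfl]
  · intro j _
    rw [mul_rep_eq]
    split_ifs <;> simp

/-- Reindexing `∑_{a=2}^{q} f(a) = ∑_{i=1}^{q-1} f(i+1)`. [folklore] -/
theorem sum_Icc_two_eq_sum_Ico (q : ℕ) (f : ℕ → ℝ) :
    ∑ a ∈ Finset.Icc (1 + 1) q, f a = ∑ i ∈ Finset.Ico 1 q, f (i + 1) := by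
  refine Finset.sum_nbij' (fun a => a - 1) (fun i => i + 1) ?_ ?_ ?_ ?_ ?_
  · intro a ha
    rw [Finset.mem_Icc] at ha
    rw [Finset.mem_Ico]; omega
  · intro i hi
    rw [Finset.mem_Ico] at hi
    rw [Finset.mem_Icc]; omega
  · intro a ha
    rw [Finset.mem_Icc] at ha
    omega
  · intro i _
    simp
  · intro a ha
    rw [Finset.mem_Icc] at ha
    rw [Nat.sub_add_cancel (by omega)]

/-- `∑_{a=1}^{q} a^{−σ} ≤ 1 + (q^{1−σ} − 1)/(1 − σ)` for `0 ≤ σ < 1` (comparison with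
`∫_1^q u^{−σ} du`). [cite: Khale2024, proof of Lemma 5.1] -/
theorem sum_rpow_neg_le {q : ℕ} (hq : 1 ≤ q) {σ : ℝ} (hσ0 : 0 ≤ σ) (hσ1 : σ < 1) :
    ∑ a ∈ Finset.Icc 1 q, (a : ℝ) ^ (-σ) ≤ 1 + ((q : ℝ) ^ (1 - σ) - 1) / (1 - σ) := by
  have hq' : (1 : ℝ) ≤ q := by exact_mod_cast hq
  rw [← Finset.insert_Icc_add_one_left_eq_Icc hq, Finset.sum_insert (by simp)]
  simp only [Nat.cast_one, Real.one_rpow]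
  gcongr
  -- `∑_{a=2}^{q} a^{-σ} ≤ ∫_1^q u^{-σ} du`
  calc ∑ a ∈ Finset.Icc (1 + 1) q, (a : ℝ) ^ (-σ)
      = ∑ i ∈ Finset.Ico 1 q, ((i + 1 : ℕ) : ℝ) ^ (-σ) := sum_Icc_two_eq_sum_Ico q _
    _ ≤ ∫ x in ((1 : ℕ) : ℝ)..q, x ^ (-σ) := by
        refine AntitoneOn.sum_le_integral_Ico (f := fun x : ℝ => x ^ (-σ)) hq ?_
        intro x hx y _ hxy
        rw [Nat.cast_one] at hx
        exact Real.rpow_le_rpow_of_nonpos (lt_of_lt_of_le one_pos hx.1) hxy (by linarith)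
    _ = ((q : ℝ) ^ (1 - σ) - 1) / (1 - σ) := by
        rw [Nat.cast_one, integral_rpow (Or.inr ⟨by linarith, by
          rw [Set.uIcc_of_le hq']; exact fun h => by linarith [h.1]⟩)]
        rw [Real.one_rpow, show -σ + 1 = 1 - σ by ring]

/-- `log q ≤ (q^{1−σ} − 1)/(1 − σ)` for `σ < 1`, `q ≥ 1` (`e^x ≥ 1 + x`). [cite: Khale2024, proof of Lemma 5.1] -/
theorem log_le_rpow_sub_one_div {q : ℝ} (hq : 1 ≤ q) {σ : ℝ} (hσ1 : σ < 1) :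
    Real.log q ≤ (q ^ (1 - σ) - 1) / (1 - σ) := by
  rw [le_div_iff₀ (by linarith), Real.rpow_def_of_pos (by linarith)]
  have := Real.add_one_le_exp (Real.log q * (1 - σ))
  linarith

/-- `1 + x ≤ 1.92 x` once `x ≥ log 3` (`log 3 ≥ 1.09`). [cite: Khale2024, proof of Lemma 5.1] -/
theorem one_add_le_of_log_three_le {x : ℝ} (hx : Real.log 3 ≤ x) : 1 + x ≤ 1.92 * x := by
  have h3 : (1.09 : ℝ) ≤ Real.log 3 := VK.log_three_ge
  nlinarith

/-! ### Lemma 5.1 -/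

/-- **The first display of the proof of Lemma 5.1**: under (2.4), for every `q ≥ 1`, every `χ`
mod `q`, `t ≥ 3` and `1/2 ≤ σ ≤ 1`,
`|L(σ + it, χ)| ≤ A q^{1−σ} t^{B(1−σ)^{3/2}} (log t)^{2/3} + ∑_{a=1}^{q} a^{−σ}`.
[cite: Khale2024, proof of Lemma 5.1] -/
theorem norm_LFunction_le_sum {A B : ℝ} (hF : HasHurwitzFordBound A B) {q : ℕ} [NeZero q]
    (χ : DirichletCharacter ℂ q) {σ t : ℝ} (ht : 3 ≤ t) (hσ : 1 / 2 ≤ σ) (hσ1 : σ ≤ 1) :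
    ‖χ.LFunction (σ + t * I)‖ ≤
      A * (q : ℝ) ^ (1 - σ) * t ^ (B * (1 - σ) ^ (3 / 2 : ℝ)) * Real.log t ^ (2 / 3 : ℝ)
        + ∑ a ∈ Finset.Icc 1 q, (a : ℝ) ^ (-σ) := by
  set s : ℂ := σ + t * I with hs
  have hqpos : (0 : ℝ) < q := Nat.cast_pos.mpr (NeZero.pos q)
  have hsre : s.re = σ := by simp [hs]
  have hqs : ‖(q : ℂ) ^ (-s)‖ = (q : ℝ) ^ (-σ) := by
    rw [Complex.norm_natCast_cpow_of_pos (NeZero.pos q), neg_re, hsre]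
  set M : ℝ := A * t ^ (B * (1 - σ) ^ (3 / 2 : ℝ)) * Real.log t ^ (2 / 3 : ℝ) with hM
  -- the two pieces
  have hdec : χ.LFunction s
      = (q : ℂ) ^ (-s) * ∑ j : ZMod q, χ j * (hurwitzZeta ((rep j : ℝ) : UnitAddCircle) s
          - ((rep j : ℝ) : ℂ) ^ (-s))
        + (q : ℂ) ^ (-s) * ∑ j : ZMod q, χ j * ((rep j : ℝ) : ℂ) ^ (-s) := by
    rw [LFunction_eq_sum_hurwitzZeta, ← mul_add, ← Finset.sum_add_distrib]
    congr 1
    refine Finset.sum_congr rfl fun j _ => ?_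
    ring
  -- first piece
  have h1 : ‖(q : ℂ) ^ (-s) * ∑ j : ZMod q, χ j * (hurwitzZeta ((rep j : ℝ) : UnitAddCircle) s
        - ((rep j : ℝ) : ℂ) ^ (-s))‖ ≤ (q : ℝ) ^ (-σ) * (q * M) := by
    rw [norm_mul, hqs]
    gcongr
    calc ‖∑ j : ZMod q, χ j * (hurwitzZeta ((rep j : ℝ) : UnitAddCircle) s - ((rep j : ℝ) : ℂ) ^ (-s))‖
        ≤ ∑ j : ZMod q, ‖χ j * (hurwitzZeta ((rep j : ℝ) : UnitAddCircle) s - ((rep j : ℝ) : ℂ) ^ (-s))‖ :=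
          norm_sum_le _ _
      _ ≤ ∑ _j : ZMod q, M := by
          refine Finset.sum_le_sum fun j _ => ?_
          rw [norm_mul]
          have hχ : ‖χ j‖ ≤ 1 := DirichletCharacter.norm_le_one χ j
          have hH := hF (rep j) (rep_pos j) (rep_le_one j) σ t ht hσ hσ1
          have hM0 : 0 ≤ M := (norm_nonneg _).trans hH
          calc ‖χ j‖ * ‖hurwitzZeta ((rep j : ℝ) : UnitAddCircle) s - ((rep j : ℝ) : ℂ) ^ (-s)‖
              ≤ 1 * M := mul_le_mul hχ hH (norm_nonneg _) zero_le_one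
            _ = M := one_mul M
      _ = q * M := by simp
  -- second piece
  have h2 : ‖(q : ℂ) ^ (-s) * ∑ j : ZMod q, χ j * ((rep j : ℝ) : ℂ) ^ (-s)‖
      ≤ ∑ a ∈ Finset.Icc 1 q, (a : ℝ) ^ (-σ) := by
    rw [← sum_mul_rep_rpow σ, norm_mul, hqs]
    have hin : ‖∑ j : ZMod q, χ j * ((rep j : ℝ) : ℂ) ^ (-s)‖ ≤ ∑ j : ZMod q, rep j ^ (-σ) := by
      refine (norm_sum_le _ _).trans (Finset.sum_le_sum fun j _ => ?_)
      have hχ : ‖χ j‖ ≤ 1 := DirichletCharacter.norm_le_one χ j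
      have hr : ‖((rep j : ℝ) : ℂ) ^ (-s)‖ = rep j ^ (-σ) := by
        rw [Complex.norm_cpow_eq_rpow_re_of_pos (rep_pos j), neg_re, hsre]
      rw [norm_mul]
      calc ‖χ j‖ * ‖((rep j : ℝ) : ℂ) ^ (-s)‖ ≤ 1 * ‖((rep j : ℝ) : ℂ) ^ (-s)‖ := by gcongr
        _ = rep j ^ (-σ) := by rw [one_mul, hr]
    calc (q : ℝ) ^ (-σ) * ‖∑ j : ZMod q, χ j * ((rep j : ℝ) : ℂ) ^ (-s)‖
        ≤ (q : ℝ) ^ (-σ) * ∑ j : ZMod q, rep j ^ (-σ) := by gcongr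
      _ = ∑ j : ZMod q, ((q : ℝ) * rep j) ^ (-σ) := by
          rw [Finset.mul_sum]
          refine Finset.sum_congr rfl fun j _ => ?_
          rw [Real.mul_rpow hqpos.le (rep_pos j).le]
  calc ‖χ.LFunction s‖ ≤ ‖(q : ℂ) ^ (-s) * ∑ j : ZMod q, χ j * (hurwitzZeta ((rep j : ℝ) : UnitAddCircle) s
          - ((rep j : ℝ) : ℂ) ^ (-s))‖
        + ‖(q : ℂ) ^ (-s) * ∑ j : ZMod q, χ j * ((rep j : ℝ) : ℂ) ^ (-s)‖ := by
          rw [hdec]; exact norm_add_le _ _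
    _ ≤ (q : ℝ) ^ (-σ) * (q * M) + ∑ a ∈ Finset.Icc 1 q, (a : ℝ) ^ (-σ) := add_le_add h1 h2
    _ = A * (q : ℝ) ^ (1 - σ) * t ^ (B * (1 - σ) ^ (3 / 2 : ℝ)) * Real.log t ^ (2 / 3 : ℝ)
        + ∑ a ∈ Finset.Icc 1 q, (a : ℝ) ^ (-σ) := by
          rw [hM, ← mul_assoc, show (q : ℝ) ^ (-σ) * q = (q : ℝ) ^ (1 - σ) by
            rw [sub_eq_neg_add, Real.rpow_add hqpos, Real.rpow_one]]
          ring

/-- **Khale 2024, Lemma 5.1** (upper half-plane form, `t ≥ 3`): under (2.4), for `q ≥ 3`, every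
`χ` mod `q`, `t ≥ 3` and `1/2 ≤ σ < 1`,
`|L(σ + it, χ)| ≤ A q^{1−σ} t^{B(1−σ)^{3/2}} (log t)^{2/3} + 1.92 (q^{1−σ} − 1)/(1 − σ)`.
[cite: Khale2024, Lemma 5.1] -/
theorem norm_LFunction_le_of_pos {A B : ℝ} (hF : HasHurwitzFordBound A B) {q : ℕ} [NeZero q]
    (hq : 3 ≤ q) (χ : DirichletCharacter ℂ q) {σ t : ℝ} (ht : 3 ≤ t) (hσ : 1 / 2 ≤ σ) (hσ1 : σ < 1) :
    ‖χ.LFunction (σ + t * I)‖ ≤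
      A * (q : ℝ) ^ (1 - σ) * t ^ (B * (1 - σ) ^ (3 / 2 : ℝ)) * Real.log t ^ (2 / 3 : ℝ)
        + 1.92 * (((q : ℝ) ^ (1 - σ) - 1) / (1 - σ)) := by
  refine (norm_LFunction_le_sum hF χ ht hσ hσ1.le).trans ?_
  gcongr
  have hq1 : 1 ≤ q := le_trans (by norm_num) hq
  have hq' : (3 : ℝ) ≤ q := by exact_mod_cast hq
  refine (sum_rpow_neg_le hq1 (by linarith) hσ1).trans (one_add_le_of_log_three_le ?_)
  exact (Real.log_le_log (by norm_num) hq').trans (log_le_rpow_sub_one_div (by linarith) hσ1)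

/-- **Khale 2024, Lemma 5.1** (as printed, `|t| ≥ 3`, `1/2 ≤ σ < 1`): under (2.4), for `q ≥ 3` and
every Dirichlet character `χ` mod `q`,
`|L(σ + it, χ)| ≤ A q^{1−σ} |t|^{B(1−σ)^{3/2}} (log|t|)^{2/3} + 1.92 (q^{1−σ} − 1)/(1 − σ)`
(negative `t` through `L(s̄, χ) = conj L(s, χ̄)`). [cite: Khale2024, Lemma 5.1] -/
theorem norm_LFunction_le {A B : ℝ} (hF : HasHurwitzFordBound A B) {q : ℕ} [NeZero q]
    (hq : 3 ≤ q) (χ : DirichletCharacter ℂ q) {σ t : ℝ} (ht : 3 ≤ |t|) (hσ : 1 / 2 ≤ σ) (hσ1 : σ < 1) :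
    ‖χ.LFunction (σ + t * I)‖ ≤
      A * (q : ℝ) ^ (1 - σ) * |t| ^ (B * (1 - σ) ^ (3 / 2 : ℝ)) * Real.log |t| ^ (2 / 3 : ℝ)
        + 1.92 * (((q : ℝ) ^ (1 - σ) - 1) / (1 - σ)) := by
  rcases le_or_gt 0 t with ht0 | ht0
  · rw [abs_of_nonneg ht0] at ht ⊢
    exact norm_LFunction_le_of_pos hF hq χ ht hσ hσ1
  · rw [abs_of_neg ht0] at ht ⊢
    -- `‖L(σ + it, χ)‖ = ‖L(σ + i|t|, χ⁻¹)‖`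
    set s' : ℂ := σ + (-t : ℝ) * I with hs'
    have hs'1 : s' ≠ 1 := by
      intro h
      have := congrArg Complex.im h
      simp [hs'] at this
      linarith
    have hconj : conj s' = σ + t * I := by
      simp only [hs', map_add, Complex.conj_ofReal, map_mul, Complex.conj_I, Complex.ofReal_neg, map_neg]
      ring
    have hnorm : ‖χ.LFunction (σ + t * I)‖ = ‖χ⁻¹.LFunction s'‖ := by
      rw [← conj_LFunction_conj_of_ne_one χ hs'1, hconj, Complex.norm_conj]
    rw [hnorm, hs']
    exact norm_LFunction_le_of_pos hF hq χ⁻¹ ht hσ hσ1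

/-- **Khale 2024, Lemma 5.1 at `σ = 1`** (the printed statement includes `σ = 1`, where
`(q^{1−σ} − 1)/(1 − σ)` means its limit `log q`): under (2.4), for `q ≥ 3`, every `χ` mod `q` and
`|t| ≥ 3`, `|L(1 + it, χ)| ≤ A (log|t|)^{2/3} + 1.92 log q`
(`∑_{a ≤ q} 1/a ≤ 1 + log q ≤ 1.92 log q`). [cite: Khale2024, Lemma 5.1] -/
theorem norm_LFunction_le_of_re_eq_one {A B : ℝ} (hF : HasHurwitzFordBound A B) {q : ℕ} [NeZero q]
    (hq : 3 ≤ q) (χ : DirichletCharacter ℂ q) {t : ℝ} (ht : 3 ≤ |t|) :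
    ‖χ.LFunction (1 + t * I)‖ ≤ A * Real.log |t| ^ (2 / 3 : ℝ) + 1.92 * Real.log q := by
  have hq1 : 1 ≤ q := le_trans (by norm_num) hq
  have hq' : (3 : ℝ) ≤ q := by exact_mod_cast hq
  -- harmonic sum
  have hharm : ∑ a ∈ Finset.Icc 1 q, (a : ℝ) ^ (-(1 : ℝ)) ≤ 1 + Real.log q := by
    rw [← Finset.insert_Icc_add_one_left_eq_Icc hq1, Finset.sum_insert (by simp)]
    simp only [Nat.cast_one, Real.one_rpow]
    gcongr
    have hanti : AntitoneOn (fun x : ℝ => x ^ (-(1 : ℝ))) (Set.Icc ((1 : ℕ) : ℝ) q) := by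
      intro x hx y _ hxy
      rw [Nat.cast_one] at hx
      exact Real.rpow_le_rpow_of_nonpos (lt_of_lt_of_le one_pos hx.1) hxy (by norm_num)
    calc ∑ a ∈ Finset.Icc (1 + 1) q, (a : ℝ) ^ (-(1 : ℝ))
        = ∑ i ∈ Finset.Ico 1 q, ((i + 1 : ℕ) : ℝ) ^ (-(1 : ℝ)) := sum_Icc_two_eq_sum_Ico q _
      _ ≤ ∫ x in ((1 : ℕ) : ℝ)..q, x ^ (-(1 : ℝ)) :=
          AntitoneOn.sum_le_integral_Ico (f := fun x : ℝ => x ^ (-(1 : ℝ))) hq1 hanti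
      _ = Real.log q := by
          rw [show (fun x : ℝ => x ^ (-(1 : ℝ))) = fun x : ℝ => x⁻¹ from funext fun x => Real.rpow_neg_one x]
          rw [Nat.cast_one, integral_inv_of_pos one_pos (by linarith), div_one]
  have main : ∀ (ψ : DirichletCharacter ℂ q) {τ : ℝ}, 3 ≤ τ →
      ‖ψ.LFunction (1 + τ * I)‖ ≤ A * Real.log τ ^ (2 / 3 : ℝ) + 1.92 * Real.log q := by
    intro ψ τ hτ
    have h := norm_LFunction_le_sum hF ψ (σ := 1) hτ (by norm_num) le_rfl
    simp only [sub_self, Real.rpow_zero, mul_one, Complex.ofReal_one] at h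
    rw [show (0 : ℝ) ^ (3 / 2 : ℝ) = 0 from Real.zero_rpow (by norm_num), mul_zero, Real.rpow_zero,
      mul_one] at h
    refine h.trans ?_
    gcongr
    refine hharm.trans (one_add_le_of_log_three_le (Real.log_le_log (by norm_num) hq'))
  rcases le_or_gt 0 t with ht0 | ht0
  · rw [abs_of_nonneg ht0] at ht ⊢
    exact main χ ht
  · rw [abs_of_neg ht0] at ht ⊢
    set s' : ℂ := 1 + (-t : ℝ) * I with hs'
    have hs'1 : s' ≠ 1 := by
      intro h
      have := congrArg Complex.im h
      simp [hs'] at this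
      linarith
    have hconj : conj s' = 1 + t * I := by
      simp only [hs', map_add, map_one, map_mul, Complex.conj_ofReal, Complex.conj_I, Complex.ofReal_neg, map_neg]
      ring
    have hnorm : ‖χ.LFunction (1 + t * I)‖ = ‖χ⁻¹.LFunction s'‖ := by
      rw [← conj_LFunction_conj_of_ne_one χ hs'1, hconj, Complex.norm_conj]
    rw [hnorm, hs']
    exact main χ⁻¹ ht

end KhaleL51

end Literature.NumberTheory.LFunctions
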